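/-
Copyright: the b2b-balaban T⁴-continuum CRUX team, row NE7b OWNER lineage `t4-ne7b-p1` (gen 147). Project licence.
-/
import Mathlib

/-!
# THE LAST PROFILE LETTERS OF THE WEIGHTED CLASS FROM ITS INTRINSIC LETTERS, AND THE SHAPE CONVERSIONS (SCOPING-d18 §E F20, tool file).
# (659)∕(666)∕(738) discharge the SUMMED profile letters of the step (`αθ, αθc, αg1m, αg2m, αg1c, αk4m·, αk4c, αk5m·, αk5c`) from the
# class's intrinsic full-graph `ϑ₂`-letters times the factor's weighted letters `αrσ, αcσ` under `σ_{vz′} ≤ ϑ₂(v,u)·σA_{uz′}`.  The order-4∕5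
# output files (667)–(671), (739)–(745) carry FIVE MORE profile hypotheses of the road's decay constants — the POINTWISE profiles
# `b^v_wσ_{vw} ≤ βθ`, `g^{pq}_wσ_{pw} ≤ βθ`, `k^{pqo}_wσ_{pw} ≤ βθ` and the UNPARTNERED row profiles `Σ_w g^{pq}_wσ_{pw} ≤ αθ`, `Σ_w k^{pqo}_wσ_{pw} ≤ αθ`
# of the `K3`- and `K4`-families (`g^{pq}_w = Σ_u|A_{uw}|K3_{pqu}`, `k^{pqo}_w = Σ_u|A_{uw}|K4_{pqou}`) — and they state the intrinsic letters in
# the SLOT shape (derivative slots `x,y,z,t,s`, summation in slot order, weight `Π_{pairs in slot order}ϑ₂`) while (666)∕(738) read the `K4`∕`K5`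
# letters in the MASS shape (anchor first, sampler index innermost).  THIS FILE supplies both: §1 the pointwise and unpartnered profiles
# (a nonnegative term is at most its sum; drop partner weights `≥ 1`); §2 slot shape ⟹ mass shape by `Finset.sum_comm` and the symmetry of
# `ϑ₂` (row NE7b, node U5c; Mathlib only; [folklore]).  With it every profile hypothesis of the weighted class map at orders 2–5 is a
# consequence of: the intrinsic `ϑ₂`-letters (slot shapes), the factor's two weighted letters, ONE compatibility — the per-order packaging
# files (next) display exactly that.

Cell `pub-balaban`, sub-cell `t4`, spine estimate NE7b (`T4WeightBudget.RelWeightBound`; the cell's OWN estimate — NOT PRINTED in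
[Bałaban 1983–89], NOT PROVED).  Crux-route work under `Spine/NE7b/` by the row OWNER (`t4-ne7b-p1` gen 147, file (747)) under FREEZE
(0)'s crux-prover clause; NOTHING of Bałaban's is named as a Lean object, valued or asserted; no `T4Continuum/Support` leaf typed; no
`def`, no notation; zero `sorry`.  Imports: Mathlib only.

WHAT IS PROVED ([folklore]): §1 `term_le_of_sum_le`, **`hk_profile_point`**, **`k3_profile_point`**, **`k4_profile_point`** (pointwise ≤ summed),
**`k3_profile_row`** (`Σ_w g^{pq}_wσ_{pw} ≤ k3rϑ·αrσ`), **`k4_profile_row`** (`Σ_w k^{pqo}_wσ_{pw} ≤ k4ϑ1·αrσ`); §2 **`hk_row_of_slot`**, **`hk_col_of_slot`**,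
**`k4_mass_shape_1∕2∕3`**, **`k5_mass_shape_1∕2∕3∕4`** (slot shape ⟹ the input shape of (659)∕(666)∕(738)); §3 `letter_nonneg₁∕₂∕₃∕₄` (a letter
bounding a nonnegative sum is nonnegative); toy.

HONEST (what this is NOT).  Letter bookkeeping; the per-order packaging statements are the next files; scalar skeleton ((A3), NC-NE7b-α
UNRULED); nothing of Bałaban's asserted.  BY-NAME EFFECT ON THE WALL: NONE.  NE7b NOT PRINTED ∕ NOT PROVED; spine PROVED 0∕9; rung (B)+1 — the
programme's measures remain FINITE-torus statements; NOT the mass gap, NOT Clay.  HONEST DEPENDENCY: continuum YM on T⁴ ⇐ BetaPertH ∧ nine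
spine estimates (0∕9 proved); BetaPertH ⇐ (D1) ∧ (D4) ∧ CAP+tail; G-an2-4 gates asym, D1 and NE2∕3∕4.
-/

set_option autoImplicit false

noncomputable section

namespace Summit.QuantumFields.BalabanUV.T4Continuum.NE7b.SupWeightedProfileDischarge

open Finset Real Matrix
open scoped BigOperators

variable {ι κ : Type} [Fintype ι] [Fintype κ]

variable {A : Matrix ι κ ℝ} {Hk : ι → ι → ℝ} {K3 : ι → ι → ι → ℝ} {K4 : ι → ι → ι → ι → ℝ} {K5 : ι → ι → ι → ι → ι → ℝ}
  {ϑ₂ : ι → ι → ℝ} {σ σA : ι → κ → ℝ} {αrσ B hrϑ hcϑ k3rϑ k4ϑ1 k4ϑ2 k4ϑ3 k5ϑ1 k5ϑ2 k5ϑ3 k5ϑ4 : ℝ}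

/-! ## §1. Pointwise and unpartnered profiles -/

omit [Fintype ι] in
/-- A nonnegative term is at most the sum it belongs to: `f w ≤ Σ_w f w ≤ B`. [folklore] -/
theorem term_le_of_sum_le {f : κ → ℝ} (hf : ∀ w, 0 ≤ f w) (h : ∑ w, f w ≤ B) (w : κ) : f w ≤ B :=
  (single_le_sum (fun w' _ => hf w') (mem_univ w)).trans h

/-- **The pointwise `Hk`-profile** (`βθ`): `b^v_w·σ_{vw} ≤ B` from the summed profile `Σ_w b^v_wσ_{vw} ≤ B`. [folklore] -/
theorem hk_profile_point (hHk0 : ∀ v u, 0 ≤ Hk v u) (hσ0 : ∀ x w, 0 ≤ σ x w)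
    (h : ∀ v, ∑ w, (∑ u, |A u w| * Hk v u) * σ v w ≤ B) (v : ι) (w : κ) : (∑ u, |A u w| * Hk v u) * σ v w ≤ B :=
  term_le_of_sum_le (f := fun w => (∑ u, |A u w| * Hk v u) * σ v w)
    (fun w => mul_nonneg (sum_nonneg fun u _ => mul_nonneg (abs_nonneg _) (hHk0 v u)) (hσ0 v w)) (h v) w

/-- **The pointwise `K3`-family profile**: `g^{pq}_w·σ_{pw} ≤ B` from `Σ_w g^{pq}_wσ_{pw} ≤ B`. [folklore] -/
theorem k3_profile_point (hK30 : ∀ x y u, 0 ≤ K3 x y u) (hσ0 : ∀ x w, 0 ≤ σ x w)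
    (h : ∀ p q, ∑ w, (∑ u, |A u w| * K3 p q u) * σ p w ≤ B) (p q : ι) (w : κ) : (∑ u, |A u w| * K3 p q u) * σ p w ≤ B :=
  term_le_of_sum_le (f := fun w => (∑ u, |A u w| * K3 p q u) * σ p w)
    (fun w => mul_nonneg (sum_nonneg fun u _ => mul_nonneg (abs_nonneg _) (hK30 p q u)) (hσ0 p w)) (h p q) w

/-- **The pointwise `K4`-family profile**: `k^{pqo}_w·σ_{pw} ≤ B` from `Σ_w k^{pqo}_wσ_{pw} ≤ B`. [folklore] -/
theorem k4_profile_point (hK40 : ∀ a b c u, 0 ≤ K4 a b c u) (hσ0 : ∀ x w, 0 ≤ σ x w)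
    (h : ∀ p q o, ∑ w, (∑ u, |A u w| * K4 p q o u) * σ p w ≤ B) (p q o : ι) (w : κ) : (∑ u, |A u w| * K4 p q o u) * σ p w ≤ B :=
  term_le_of_sum_le (f := fun w => (∑ u, |A u w| * K4 p q o u) * σ p w)
    (fun w => mul_nonneg (sum_nonneg fun u _ => mul_nonneg (abs_nonneg _) (hK40 p q o u)) (hσ0 p w)) (h p q o) w

/-- **The unpartnered `K3`-family row profile**: `Σ_w g^{pq}_wσ_{pw} ≤ k3rϑ·αrσ` from the full-graph first-index letter (slot shape)
`Σ_{y,v}K3_{xyv}ϑ₂(x,y)ϑ₂(x,v)ϑ₂(y,v) ≤ k3rϑ` — route `σ_{pw} ≤ ϑ₂(p,u)σA_{uw}`, keep the `y = q` term, drop partner weights `≥ 1`. [folklore] -/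
theorem k3_profile_row (hK30 : ∀ x y u, 0 ≤ K3 x y u) (hϑ₂1 : ∀ x y, 1 ≤ ϑ₂ x y)
    (hσϑ : ∀ v u z', σ v z' ≤ ϑ₂ v u * σA u z') (hAr : ∀ u, ∑ z', |A u z'| * σA u z' ≤ αrσ) (hα0 : 0 ≤ αrσ)
    (hk3r : ∀ x, ∑ y, ∑ v, K3 x y v * (ϑ₂ x y * ϑ₂ x v * ϑ₂ y v) ≤ k3rϑ) (p q : ι) :
    ∑ w, (∑ u, |A u w| * K3 p q u) * σ p w ≤ k3rϑ * αrσ := by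
  have hϑ₂0 : ∀ x y, 0 ≤ ϑ₂ x y := fun x y => zero_le_one.trans (hϑ₂1 x y)
  have hW : ∀ u, ϑ₂ p u ≤ ϑ₂ p q * ϑ₂ p u * ϑ₂ q u := fun u =>
    calc ϑ₂ p u = 1 * ϑ₂ p u * 1 := by ring
      _ ≤ ϑ₂ p q * ϑ₂ p u * ϑ₂ q u :=
          mul_le_mul (mul_le_mul_of_nonneg_right (hϑ₂1 p q) (hϑ₂0 p u)) (hϑ₂1 q u) zero_le_one (mul_nonneg (hϑ₂0 p q) (hϑ₂0 p u))
  calc ∑ w, (∑ u, |A u w| * K3 p q u) * σ p w ≤ ∑ w, ∑ u, K3 p q u * ϑ₂ p u * (|A u w| * σA u w) := by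
        refine sum_le_sum fun w _ => ?_
        rw [sum_mul]
        refine sum_le_sum fun u _ => ?_
        calc |A u w| * K3 p q u * σ p w ≤ |A u w| * K3 p q u * (ϑ₂ p u * σA u w) :=
              mul_le_mul_of_nonneg_left (hσϑ p u w) (mul_nonneg (abs_nonneg _) (hK30 p q u))
          _ = K3 p q u * ϑ₂ p u * (|A u w| * σA u w) := by ring
    _ = ∑ u, K3 p q u * ϑ₂ p u * ∑ w, |A u w| * σA u w := by rw [sum_comm]; exact sum_congr rfl fun u _ => by rw [mul_sum]
    _ ≤ ∑ u, K3 p q u * ϑ₂ p u * αrσ := sum_le_sum fun u _ => mul_le_mul_of_nonneg_left (hAr u) (mul_nonneg (hK30 p q u) (hϑ₂0 p u))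
    _ = (∑ u, K3 p q u * ϑ₂ p u) * αrσ := by rw [sum_mul]
    _ ≤ (∑ y, ∑ v, K3 p y v * (ϑ₂ p y * ϑ₂ p v * ϑ₂ y v)) * αrσ := by
        refine mul_le_mul_of_nonneg_right ?_ hα0
        calc ∑ u, K3 p q u * ϑ₂ p u ≤ ∑ v, K3 p q v * (ϑ₂ p q * ϑ₂ p v * ϑ₂ q v) :=
              sum_le_sum fun u _ => mul_le_mul_of_nonneg_left (hW u) (hK30 p q u)
          _ ≤ ∑ y, ∑ v, K3 p y v * (ϑ₂ p y * ϑ₂ p v * ϑ₂ y v) :=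
              single_le_sum (f := fun y => ∑ v, K3 p y v * (ϑ₂ p y * ϑ₂ p v * ϑ₂ y v))
                (fun y _ => sum_nonneg fun v _ => mul_nonneg (hK30 p y v) (mul_nonneg (mul_nonneg (hϑ₂0 p y) (hϑ₂0 p v)) (hϑ₂0 y v)))
                (mem_univ q)
    _ ≤ k3rϑ * αrσ := mul_le_mul_of_nonneg_right (hk3r p) hα0

/-- **The unpartnered `K4`-family row profile**: `Σ_w k^{pqo}_wσ_{pw} ≤ k4ϑ1·αrσ` from the full-graph letter of the first `K4`-index in its
SLOT shape (slot `y` of the order-4 files: `Σ_{x,z,t}K4_{yztx}·ϑ₂(x,y)ϑ₂(x,z)ϑ₂(x,t)ϑ₂(y,z)ϑ₂(y,t)ϑ₂(z,t) ≤ k4ϑ1`). [folklore] -/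
theorem k4_profile_row (hK40 : ∀ a b c u, 0 ≤ K4 a b c u) (hϑ₂1 : ∀ x y, 1 ≤ ϑ₂ x y) (hϑ₂symm : ∀ x y, ϑ₂ x y = ϑ₂ y x)
    (hσϑ : ∀ v u z', σ v z' ≤ ϑ₂ v u * σA u z') (hAr : ∀ u, ∑ z', |A u z'| * σA u z' ≤ αrσ) (hα0 : 0 ≤ αrσ)
    (hk4y : ∀ y, ∑ x, ∑ z, ∑ t, K4 y z t x * (ϑ₂ x y * ϑ₂ x z * ϑ₂ x t * ϑ₂ y z * ϑ₂ y t * ϑ₂ z t) ≤ k4ϑ1) (p q o : ι) :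
    ∑ w, (∑ u, |A u w| * K4 p q o u) * σ p w ≤ k4ϑ1 * αrσ := by
  have hϑ₂0 : ∀ x y, 0 ≤ ϑ₂ x y := fun x y => zero_le_one.trans (hϑ₂1 x y)
  have h11 : ∀ a b c d : ι, (1 : ℝ) ≤ ϑ₂ a b * ϑ₂ c d := fun a b c d => one_le_mul_of_one_le_of_one_le (hϑ₂1 a b) (hϑ₂1 c d)
  have hW : ∀ u, ϑ₂ p u ≤ ϑ₂ u p * ϑ₂ u q * ϑ₂ u o * ϑ₂ p q * ϑ₂ p o * ϑ₂ q o := fun u =>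
    calc ϑ₂ p u = ϑ₂ u p * 1 * 1 * 1 := by rw [hϑ₂symm p u]; ring
      _ ≤ ϑ₂ u p * (ϑ₂ u q * ϑ₂ u o) * (ϑ₂ p q * ϑ₂ p o) * ϑ₂ q o :=
          mul_le_mul (mul_le_mul (mul_le_mul_of_nonneg_left (h11 u q u o) (hϑ₂0 u p)) (h11 p q p o) zero_le_one
            (mul_nonneg (hϑ₂0 u p) (mul_nonneg (hϑ₂0 u q) (hϑ₂0 u o)))) (hϑ₂1 q o) zero_le_one
            (mul_nonneg (mul_nonneg (hϑ₂0 u p) (mul_nonneg (hϑ₂0 u q) (hϑ₂0 u o))) (mul_nonneg (hϑ₂0 p q) (hϑ₂0 p o)))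
      _ = ϑ₂ u p * ϑ₂ u q * ϑ₂ u o * ϑ₂ p q * ϑ₂ p o * ϑ₂ q o := by ring
  have hT0 : ∀ x z t, 0 ≤ K4 p z t x * (ϑ₂ x p * ϑ₂ x z * ϑ₂ x t * ϑ₂ p z * ϑ₂ p t * ϑ₂ z t) := fun x z t =>
    mul_nonneg (hK40 p z t x) (mul_nonneg (mul_nonneg (mul_nonneg (mul_nonneg (mul_nonneg (hϑ₂0 x p) (hϑ₂0 x z)) (hϑ₂0 x t))
      (hϑ₂0 p z)) (hϑ₂0 p t)) (hϑ₂0 z t))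
  calc ∑ w, (∑ u, |A u w| * K4 p q o u) * σ p w ≤ ∑ w, ∑ u, K4 p q o u * ϑ₂ p u * (|A u w| * σA u w) := by
        refine sum_le_sum fun w _ => ?_
        rw [sum_mul]
        refine sum_le_sum fun u _ => ?_
        calc |A u w| * K4 p q o u * σ p w ≤ |A u w| * K4 p q o u * (ϑ₂ p u * σA u w) :=
              mul_le_mul_of_nonneg_left (hσϑ p u w) (mul_nonneg (abs_nonneg _) (hK40 p q o u))
          _ = K4 p q o u * ϑ₂ p u * (|A u w| * σA u w) := by ring
    _ = ∑ u, K4 p q o u * ϑ₂ p u * ∑ w, |A u w| * σA u w := by rw [sum_comm]; exact sum_congr rfl fun u _ => by rw [mul_sum]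
    _ ≤ ∑ u, K4 p q o u * ϑ₂ p u * αrσ := sum_le_sum fun u _ => mul_le_mul_of_nonneg_left (hAr u) (mul_nonneg (hK40 p q o u) (hϑ₂0 p u))
    _ = (∑ u, K4 p q o u * ϑ₂ p u) * αrσ := by rw [sum_mul]
    _ ≤ (∑ x, ∑ z, ∑ t, K4 p z t x * (ϑ₂ x p * ϑ₂ x z * ϑ₂ x t * ϑ₂ p z * ϑ₂ p t * ϑ₂ z t)) * αrσ := by
        refine mul_le_mul_of_nonneg_right ?_ hα0
        calc ∑ u, K4 p q o u * ϑ₂ p u ≤ ∑ x, K4 p q o x * (ϑ₂ x p * ϑ₂ x q * ϑ₂ x o * ϑ₂ p q * ϑ₂ p o * ϑ₂ q o) :=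
              sum_le_sum fun u _ => mul_le_mul_of_nonneg_left (hW u) (hK40 p q o u)
          _ ≤ ∑ x, ∑ z, ∑ t, K4 p z t x * (ϑ₂ x p * ϑ₂ x z * ϑ₂ x t * ϑ₂ p z * ϑ₂ p t * ϑ₂ z t) := by
              refine sum_le_sum fun x _ => ?_
              calc K4 p q o x * (ϑ₂ x p * ϑ₂ x q * ϑ₂ x o * ϑ₂ p q * ϑ₂ p o * ϑ₂ q o)
                  ≤ ∑ t, K4 p q t x * (ϑ₂ x p * ϑ₂ x q * ϑ₂ x t * ϑ₂ p q * ϑ₂ p t * ϑ₂ q t) :=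
                    single_le_sum (f := fun t => K4 p q t x * (ϑ₂ x p * ϑ₂ x q * ϑ₂ x t * ϑ₂ p q * ϑ₂ p t * ϑ₂ q t))
                      (fun t _ => hT0 x q t) (mem_univ o)
                _ ≤ ∑ z, ∑ t, K4 p z t x * (ϑ₂ x p * ϑ₂ x z * ϑ₂ x t * ϑ₂ p z * ϑ₂ p t * ϑ₂ z t) :=
                    single_le_sum (f := fun z => ∑ t, K4 p z t x * (ϑ₂ x p * ϑ₂ x z * ϑ₂ x t * ϑ₂ p z * ϑ₂ p t * ϑ₂ z t))
                      (fun z _ => sum_nonneg fun t _ => hT0 x z t) (mem_univ q)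
    _ ≤ k4ϑ1 * αrσ := mul_le_mul_of_nonneg_right (hk4y p) hα0

/-! ## §2. Slot shape ⟹ mass shape -/

omit [Fintype κ] in
/-- `Hk` rows: `Σ_u ϑ₂(v,u)Hk_{vu}` (slot files) is `Σ_u Hk_{vu}ϑ₂(v,u)` ((659)). [folklore] -/
theorem hk_row_of_slot (h : ∀ a, ∑ b, ϑ₂ a b * Hk a b ≤ hrϑ) (v : ι) : ∑ u, Hk v u * ϑ₂ v u ≤ hrϑ :=
  (sum_congr rfl fun _ _ => mul_comm _ _).trans_le (h v)

omit [Fintype κ] in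
/-- `Hk` columns: `Σ_b ϑ₂(a,b)Hk_{ba}` (slot files) is `Σ_v Hk_{vu}ϑ₂(v,u)` ((659)) by the symmetry of `ϑ₂`. [folklore] -/
theorem hk_col_of_slot (hϑ₂symm : ∀ x y, ϑ₂ x y = ϑ₂ y x) (h : ∀ a, ∑ b, ϑ₂ a b * Hk b a ≤ hcϑ) (u : ι) :
    ∑ v, Hk v u * ϑ₂ v u ≤ hcϑ :=
  (sum_congr rfl fun v _ => by rw [hϑ₂symm v u, mul_comm]).trans_le (h u)

omit [Fintype κ] in
/-- `K4`, first index (slot `y` shape ⟹ (666) `k4_mass_1`'s shape). [folklore] -/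
theorem k4_mass_shape_1 (hϑ₂symm : ∀ x y, ϑ₂ x y = ϑ₂ y x)
    (h : ∀ y, ∑ x, ∑ z, ∑ t, K4 y z t x * (ϑ₂ x y * ϑ₂ x z * ϑ₂ x t * ϑ₂ y z * ϑ₂ y t * ϑ₂ z t) ≤ k4ϑ1) (s : ι) :
    ∑ p, ∑ q, ∑ u, K4 s p q u * (ϑ₂ s p * ϑ₂ s q * ϑ₂ s u * ϑ₂ p q * ϑ₂ p u * ϑ₂ q u) ≤ k4ϑ1 :=
  calc ∑ p, ∑ q, ∑ u, K4 s p q u * (ϑ₂ s p * ϑ₂ s q * ϑ₂ s u * ϑ₂ p q * ϑ₂ p u * ϑ₂ q u)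
      = ∑ p, ∑ u, ∑ q, K4 s p q u * (ϑ₂ s p * ϑ₂ s q * ϑ₂ s u * ϑ₂ p q * ϑ₂ p u * ϑ₂ q u) := sum_congr rfl fun p _ => sum_comm
    _ = ∑ u, ∑ p, ∑ q, K4 s p q u * (ϑ₂ s p * ϑ₂ s q * ϑ₂ s u * ϑ₂ p q * ϑ₂ p u * ϑ₂ q u) := sum_comm
    _ = ∑ x, ∑ z, ∑ t, K4 s z t x * (ϑ₂ x s * ϑ₂ x z * ϑ₂ x t * ϑ₂ s z * ϑ₂ s t * ϑ₂ z t) :=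
        sum_congr rfl fun x _ => sum_congr rfl fun z _ => sum_congr rfl fun t _ => by rw [hϑ₂symm s x, hϑ₂symm z x, hϑ₂symm t x]; ring
    _ ≤ k4ϑ1 := h s

omit [Fintype κ] in
/-- `K4`, second index (slot `z` shape ⟹ (666) `k4_mass_2`'s shape). [folklore] -/
theorem k4_mass_shape_2 (hϑ₂symm : ∀ x y, ϑ₂ x y = ϑ₂ y x)
    (h : ∀ z, ∑ x, ∑ y, ∑ t, K4 y z t x * (ϑ₂ x y * ϑ₂ x z * ϑ₂ x t * ϑ₂ y z * ϑ₂ y t * ϑ₂ z t) ≤ k4ϑ2) (s : ι) :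
    ∑ p, ∑ q, ∑ u, K4 p s q u * (ϑ₂ s p * ϑ₂ s q * ϑ₂ s u * ϑ₂ p q * ϑ₂ p u * ϑ₂ q u) ≤ k4ϑ2 :=
  calc ∑ p, ∑ q, ∑ u, K4 p s q u * (ϑ₂ s p * ϑ₂ s q * ϑ₂ s u * ϑ₂ p q * ϑ₂ p u * ϑ₂ q u)
      = ∑ p, ∑ u, ∑ q, K4 p s q u * (ϑ₂ s p * ϑ₂ s q * ϑ₂ s u * ϑ₂ p q * ϑ₂ p u * ϑ₂ q u) := sum_congr rfl fun p _ => sum_comm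
    _ = ∑ u, ∑ p, ∑ q, K4 p s q u * (ϑ₂ s p * ϑ₂ s q * ϑ₂ s u * ϑ₂ p q * ϑ₂ p u * ϑ₂ q u) := sum_comm
    _ = ∑ x, ∑ y, ∑ t, K4 y s t x * (ϑ₂ x y * ϑ₂ x s * ϑ₂ x t * ϑ₂ y s * ϑ₂ y t * ϑ₂ s t) :=
        sum_congr rfl fun x _ => sum_congr rfl fun y _ => sum_congr rfl fun t _ => by
          rw [hϑ₂symm s x, hϑ₂symm y x, hϑ₂symm t x, hϑ₂symm s y]; ring
    _ ≤ k4ϑ2 := h s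

omit [Fintype κ] in
/-- `K4`, third index (slot `t` shape ⟹ (666) `k4_mass_3`'s shape). [folklore] -/
theorem k4_mass_shape_3 (hϑ₂symm : ∀ x y, ϑ₂ x y = ϑ₂ y x)
    (h : ∀ t, ∑ x, ∑ y, ∑ z, K4 y z t x * (ϑ₂ x y * ϑ₂ x z * ϑ₂ x t * ϑ₂ y z * ϑ₂ y t * ϑ₂ z t) ≤ k4ϑ3) (s : ι) :
    ∑ p, ∑ q, ∑ u, K4 p q s u * (ϑ₂ s p * ϑ₂ s q * ϑ₂ s u * ϑ₂ p q * ϑ₂ p u * ϑ₂ q u) ≤ k4ϑ3 :=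
  calc ∑ p, ∑ q, ∑ u, K4 p q s u * (ϑ₂ s p * ϑ₂ s q * ϑ₂ s u * ϑ₂ p q * ϑ₂ p u * ϑ₂ q u)
      = ∑ p, ∑ u, ∑ q, K4 p q s u * (ϑ₂ s p * ϑ₂ s q * ϑ₂ s u * ϑ₂ p q * ϑ₂ p u * ϑ₂ q u) := sum_congr rfl fun p _ => sum_comm
    _ = ∑ u, ∑ p, ∑ q, K4 p q s u * (ϑ₂ s p * ϑ₂ s q * ϑ₂ s u * ϑ₂ p q * ϑ₂ p u * ϑ₂ q u) := sum_comm
    _ = ∑ x, ∑ y, ∑ z, K4 y z s x * (ϑ₂ x y * ϑ₂ x z * ϑ₂ x s * ϑ₂ y z * ϑ₂ y s * ϑ₂ z s) :=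
        sum_congr rfl fun x _ => sum_congr rfl fun y _ => sum_congr rfl fun z _ => by
          rw [hϑ₂symm s x, hϑ₂symm y x, hϑ₂symm z x, hϑ₂symm s y, hϑ₂symm s z]; ring
    _ ≤ k4ϑ3 := h s

omit [Fintype κ] in
/-- `K5`, first index (slot `y` shape ⟹ (738) `k5_mass_1`'s shape). [folklore] -/
theorem k5_mass_shape_1 (hϑ₂symm : ∀ x y, ϑ₂ x y = ϑ₂ y x)
    (h : ∀ y, ∑ x, ∑ z, ∑ t, ∑ s, K5 y z t s x *
      (ϑ₂ x y * ϑ₂ x z * ϑ₂ x t * ϑ₂ x s * ϑ₂ y z * ϑ₂ y t * ϑ₂ y s * ϑ₂ z t * ϑ₂ z s * ϑ₂ t s) ≤ k5ϑ1) (o : ι) :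
    ∑ a, ∑ b, ∑ c, ∑ u, K5 o a b c u * (ϑ₂ o a * ϑ₂ o b * ϑ₂ o c * ϑ₂ o u * ϑ₂ a b * ϑ₂ a c * ϑ₂ a u * ϑ₂ b c * ϑ₂ b u * ϑ₂ c u) ≤ k5ϑ1 :=
  calc ∑ a, ∑ b, ∑ c, ∑ u, K5 o a b c u * (ϑ₂ o a * ϑ₂ o b * ϑ₂ o c * ϑ₂ o u * ϑ₂ a b * ϑ₂ a c * ϑ₂ a u * ϑ₂ b c * ϑ₂ b u * ϑ₂ c u)
      = ∑ a, ∑ b, ∑ u, ∑ c, K5 o a b c u * (ϑ₂ o a * ϑ₂ o b * ϑ₂ o c * ϑ₂ o u * ϑ₂ a b * ϑ₂ a c * ϑ₂ a u * ϑ₂ b c * ϑ₂ b u * ϑ₂ c u) :=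
        sum_congr rfl fun a _ => sum_congr rfl fun b _ => sum_comm
    _ = ∑ a, ∑ u, ∑ b, ∑ c, K5 o a b c u * (ϑ₂ o a * ϑ₂ o b * ϑ₂ o c * ϑ₂ o u * ϑ₂ a b * ϑ₂ a c * ϑ₂ a u * ϑ₂ b c * ϑ₂ b u * ϑ₂ c u) :=
        sum_congr rfl fun a _ => sum_comm
    _ = ∑ u, ∑ a, ∑ b, ∑ c, K5 o a b c u * (ϑ₂ o a * ϑ₂ o b * ϑ₂ o c * ϑ₂ o u * ϑ₂ a b * ϑ₂ a c * ϑ₂ a u * ϑ₂ b c * ϑ₂ b u * ϑ₂ c u) :=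
        sum_comm
    _ = ∑ x, ∑ z, ∑ t, ∑ s, K5 o z t s x * (ϑ₂ x o * ϑ₂ x z * ϑ₂ x t * ϑ₂ x s * ϑ₂ o z * ϑ₂ o t * ϑ₂ o s * ϑ₂ z t * ϑ₂ z s * ϑ₂ t s) :=
        sum_congr rfl fun x _ => sum_congr rfl fun z _ => sum_congr rfl fun t _ => sum_congr rfl fun s _ => by
          rw [hϑ₂symm o x, hϑ₂symm z x, hϑ₂symm t x, hϑ₂symm s x]; ring
    _ ≤ k5ϑ1 := h o

omit [Fintype κ] in
/-- `K5`, second index (slot `z` shape ⟹ (738) `k5_mass_2`'s shape). [folklore] -/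
theorem k5_mass_shape_2 (hϑ₂symm : ∀ x y, ϑ₂ x y = ϑ₂ y x)
    (h : ∀ z, ∑ x, ∑ y, ∑ t, ∑ s, K5 y z t s x *
      (ϑ₂ x y * ϑ₂ x z * ϑ₂ x t * ϑ₂ x s * ϑ₂ y z * ϑ₂ y t * ϑ₂ y s * ϑ₂ z t * ϑ₂ z s * ϑ₂ t s) ≤ k5ϑ2) (o : ι) :
    ∑ a, ∑ b, ∑ c, ∑ u, K5 a o b c u * (ϑ₂ o a * ϑ₂ o b * ϑ₂ o c * ϑ₂ o u * ϑ₂ a b * ϑ₂ a c * ϑ₂ a u * ϑ₂ b c * ϑ₂ b u * ϑ₂ c u) ≤ k5ϑ2 :=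
  calc ∑ a, ∑ b, ∑ c, ∑ u, K5 a o b c u * (ϑ₂ o a * ϑ₂ o b * ϑ₂ o c * ϑ₂ o u * ϑ₂ a b * ϑ₂ a c * ϑ₂ a u * ϑ₂ b c * ϑ₂ b u * ϑ₂ c u)
      = ∑ a, ∑ b, ∑ u, ∑ c, K5 a o b c u * (ϑ₂ o a * ϑ₂ o b * ϑ₂ o c * ϑ₂ o u * ϑ₂ a b * ϑ₂ a c * ϑ₂ a u * ϑ₂ b c * ϑ₂ b u * ϑ₂ c u) :=
        sum_congr rfl fun a _ => sum_congr rfl fun b _ => sum_comm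
    _ = ∑ a, ∑ u, ∑ b, ∑ c, K5 a o b c u * (ϑ₂ o a * ϑ₂ o b * ϑ₂ o c * ϑ₂ o u * ϑ₂ a b * ϑ₂ a c * ϑ₂ a u * ϑ₂ b c * ϑ₂ b u * ϑ₂ c u) :=
        sum_congr rfl fun a _ => sum_comm
    _ = ∑ u, ∑ a, ∑ b, ∑ c, K5 a o b c u * (ϑ₂ o a * ϑ₂ o b * ϑ₂ o c * ϑ₂ o u * ϑ₂ a b * ϑ₂ a c * ϑ₂ a u * ϑ₂ b c * ϑ₂ b u * ϑ₂ c u) :=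
        sum_comm
    _ = ∑ x, ∑ y, ∑ t, ∑ s, K5 y o t s x * (ϑ₂ x y * ϑ₂ x o * ϑ₂ x t * ϑ₂ x s * ϑ₂ y o * ϑ₂ y t * ϑ₂ y s * ϑ₂ o t * ϑ₂ o s * ϑ₂ t s) :=
        sum_congr rfl fun x _ => sum_congr rfl fun y _ => sum_congr rfl fun t _ => sum_congr rfl fun s _ => by
          rw [hϑ₂symm o x, hϑ₂symm y x, hϑ₂symm t x, hϑ₂symm s x, hϑ₂symm o y]; ring
    _ ≤ k5ϑ2 := h o

omit [Fintype κ] in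
/-- `K5`, third index (slot `t` shape ⟹ (738) `k5_mass_3`'s shape). [folklore] -/
theorem k5_mass_shape_3 (hϑ₂symm : ∀ x y, ϑ₂ x y = ϑ₂ y x)
    (h : ∀ t, ∑ x, ∑ y, ∑ z, ∑ s, K5 y z t s x *
      (ϑ₂ x y * ϑ₂ x z * ϑ₂ x t * ϑ₂ x s * ϑ₂ y z * ϑ₂ y t * ϑ₂ y s * ϑ₂ z t * ϑ₂ z s * ϑ₂ t s) ≤ k5ϑ3) (o : ι) :
    ∑ a, ∑ b, ∑ c, ∑ u, K5 a b o c u * (ϑ₂ o a * ϑ₂ o b * ϑ₂ o c * ϑ₂ o u * ϑ₂ a b * ϑ₂ a c * ϑ₂ a u * ϑ₂ b c * ϑ₂ b u * ϑ₂ c u) ≤ k5ϑ3 :=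
  calc ∑ a, ∑ b, ∑ c, ∑ u, K5 a b o c u * (ϑ₂ o a * ϑ₂ o b * ϑ₂ o c * ϑ₂ o u * ϑ₂ a b * ϑ₂ a c * ϑ₂ a u * ϑ₂ b c * ϑ₂ b u * ϑ₂ c u)
      = ∑ a, ∑ b, ∑ u, ∑ c, K5 a b o c u * (ϑ₂ o a * ϑ₂ o b * ϑ₂ o c * ϑ₂ o u * ϑ₂ a b * ϑ₂ a c * ϑ₂ a u * ϑ₂ b c * ϑ₂ b u * ϑ₂ c u) :=
        sum_congr rfl fun a _ => sum_congr rfl fun b _ => sum_comm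
    _ = ∑ a, ∑ u, ∑ b, ∑ c, K5 a b o c u * (ϑ₂ o a * ϑ₂ o b * ϑ₂ o c * ϑ₂ o u * ϑ₂ a b * ϑ₂ a c * ϑ₂ a u * ϑ₂ b c * ϑ₂ b u * ϑ₂ c u) :=
        sum_congr rfl fun a _ => sum_comm
    _ = ∑ u, ∑ a, ∑ b, ∑ c, K5 a b o c u * (ϑ₂ o a * ϑ₂ o b * ϑ₂ o c * ϑ₂ o u * ϑ₂ a b * ϑ₂ a c * ϑ₂ a u * ϑ₂ b c * ϑ₂ b u * ϑ₂ c u) :=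
        sum_comm
    _ = ∑ x, ∑ y, ∑ z, ∑ s, K5 y z o s x * (ϑ₂ x y * ϑ₂ x z * ϑ₂ x o * ϑ₂ x s * ϑ₂ y z * ϑ₂ y o * ϑ₂ y s * ϑ₂ z o * ϑ₂ z s * ϑ₂ o s) :=
        sum_congr rfl fun x _ => sum_congr rfl fun y _ => sum_congr rfl fun z _ => sum_congr rfl fun s _ => by
          rw [hϑ₂symm o x, hϑ₂symm y x, hϑ₂symm z x, hϑ₂symm s x, hϑ₂symm o y, hϑ₂symm o z]; ring
    _ ≤ k5ϑ3 := h o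

omit [Fintype κ] in
/-- `K5`, fourth index (slot `s` shape ⟹ (738) `k5_mass_4`'s shape). [folklore] -/
theorem k5_mass_shape_4 (hϑ₂symm : ∀ x y, ϑ₂ x y = ϑ₂ y x)
    (h : ∀ s, ∑ x, ∑ y, ∑ z, ∑ t, K5 y z t s x *
      (ϑ₂ x y * ϑ₂ x z * ϑ₂ x t * ϑ₂ x s * ϑ₂ y z * ϑ₂ y t * ϑ₂ y s * ϑ₂ z t * ϑ₂ z s * ϑ₂ t s) ≤ k5ϑ4) (o : ι) :
    ∑ a, ∑ b, ∑ c, ∑ u, K5 a b c o u * (ϑ₂ o a * ϑ₂ o b * ϑ₂ o c * ϑ₂ o u * ϑ₂ a b * ϑ₂ a c * ϑ₂ a u * ϑ₂ b c * ϑ₂ b u * ϑ₂ c u) ≤ k5ϑ4 :=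
  calc ∑ a, ∑ b, ∑ c, ∑ u, K5 a b c o u * (ϑ₂ o a * ϑ₂ o b * ϑ₂ o c * ϑ₂ o u * ϑ₂ a b * ϑ₂ a c * ϑ₂ a u * ϑ₂ b c * ϑ₂ b u * ϑ₂ c u)
      = ∑ a, ∑ b, ∑ u, ∑ c, K5 a b c o u * (ϑ₂ o a * ϑ₂ o b * ϑ₂ o c * ϑ₂ o u * ϑ₂ a b * ϑ₂ a c * ϑ₂ a u * ϑ₂ b c * ϑ₂ b u * ϑ₂ c u) :=
        sum_congr rfl fun a _ => sum_congr rfl fun b _ => sum_comm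
    _ = ∑ a, ∑ u, ∑ b, ∑ c, K5 a b c o u * (ϑ₂ o a * ϑ₂ o b * ϑ₂ o c * ϑ₂ o u * ϑ₂ a b * ϑ₂ a c * ϑ₂ a u * ϑ₂ b c * ϑ₂ b u * ϑ₂ c u) :=
        sum_congr rfl fun a _ => sum_comm
    _ = ∑ u, ∑ a, ∑ b, ∑ c, K5 a b c o u * (ϑ₂ o a * ϑ₂ o b * ϑ₂ o c * ϑ₂ o u * ϑ₂ a b * ϑ₂ a c * ϑ₂ a u * ϑ₂ b c * ϑ₂ b u * ϑ₂ c u) :=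
        sum_comm
    _ = ∑ x, ∑ y, ∑ z, ∑ t, K5 y z t o x * (ϑ₂ x y * ϑ₂ x z * ϑ₂ x t * ϑ₂ x o * ϑ₂ y z * ϑ₂ y t * ϑ₂ y o * ϑ₂ z t * ϑ₂ z o * ϑ₂ t o) :=
        sum_congr rfl fun x _ => sum_congr rfl fun y _ => sum_congr rfl fun z _ => sum_congr rfl fun t _ => by
          rw [hϑ₂symm o x, hϑ₂symm y x, hϑ₂symm z x, hϑ₂symm t x, hϑ₂symm o y, hϑ₂symm o z, hϑ₂symm o t]; ring
    _ ≤ k5ϑ4 := h o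

/-! ## §3. Letters bounding nonnegative sums are nonnegative -/

omit [Fintype κ] in
/-- One summation index. [folklore] -/
theorem letter_nonneg₁ {f : ι → ℝ} (hf : ∀ a, 0 ≤ f a) (h : ∑ a, f a ≤ B) : 0 ≤ B := (sum_nonneg fun a _ => hf a).trans h

omit [Fintype κ] in
/-- Two summation indices. [folklore] -/
theorem letter_nonneg₂ {f : ι → ι → ℝ} (hf : ∀ a b, 0 ≤ f a b) (h : ∑ a, ∑ b, f a b ≤ B) : 0 ≤ B :=
  (sum_nonneg fun a _ => sum_nonneg fun b _ => hf a b).trans h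

omit [Fintype κ] in
/-- Three summation indices. [folklore] -/
theorem letter_nonneg₃ {f : ι → ι → ι → ℝ} (hf : ∀ a b c, 0 ≤ f a b c) (h : ∑ a, ∑ b, ∑ c, f a b c ≤ B) : 0 ≤ B :=
  (sum_nonneg fun a _ => sum_nonneg fun b _ => sum_nonneg fun c _ => hf a b c).trans h

omit [Fintype κ] in
/-- Four summation indices. [folklore] -/
theorem letter_nonneg₄ {f : ι → ι → ι → ι → ℝ} (hf : ∀ a b c d, 0 ≤ f a b c d) (h : ∑ a, ∑ b, ∑ c, ∑ d, f a b c d ≤ B) : 0 ≤ B :=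
  (sum_nonneg fun a _ => sum_nonneg fun b _ => sum_nonneg fun c _ => sum_nonneg fun d _ => hf a b c d).trans h

/-! ## Toy -/

/-- Toy (a nonnegative term is at most its sum): `2 ≤ 1 + 2 + 3`. -/
example : (2 : ℝ) ≤ 1 + 2 + 3 := by norm_num

end Summit.QuantumFields.BalabanUV.T4Continuum.NE7b.SupWeightedProfileDischarge

end
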